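import Literature.AlgebraicGeometry.Surfaces.K3MainInvariantsRealization
import Literature.Topology.FourManifolds.LatticeFormsTwoElementaryInvolutionExtension
import HarnessLib

/-!
# Involutions of the K3 lattice with hyperbolic invariant lattice: their main invariants `(r, a, δ)` are exactly
# the 75 triples of Figure 1 (Alexeev–Nikulin, *Del Pezzo and K3 surfaces*, §2.2, §9.2 — lattice-theoretic part)

Alexeev–Nikulin §2.2 attach to a K3 surface `X` with a non-symplectic involution `θ` the invariant lattice
`S = H²(X, ℤ)^θ` — hyperbolic, 2-elementary (p0019: "The involution `θ` is `+1` on `S^*/S`, and it is `−1` on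
`T^*/T`. It follows that … `S` is 2-elementary"), with main invariants `(r, a, δ)` — and state (§2.2 p0019, §9.2
p0053) that the possible `(r, a, δ)` are exactly those of Figure 1. This file assembles the LATTICE-THEORETIC
content of that classification for the K3 lattice `Λ_{K3} = Matrix.toBilin' k3Gram`, from the tree's pieces:
2-elementary primitive `S` are exactly invariant lattices of isometric involutions
(`LatticeFormsTwoElementaryInvolution(Extension).lean`), the invariants of a primitive 2-elementary hyperbolic
`S ⊂ Λ_{K3}` lie in Figure 1 (`K3MainInvariantsFigureOne.lean`), and every triple of Figure 1 is realised
(`K3MainInvariantsRealization.lean`). Result: **`(r, a, δ) ∈ nikulinMainInvariants` iff there is an isometric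
involution `θ` of `Λ_{K3}` whose invariant lattice `Λ_{K3}^θ` is nondegenerate hyperbolic with
`(rk, ℓ, δ) = (r, a, δ)`.** Written for lane `lit-hodgefound` (Track 2 foundations; prover seat
`lit-hodgefound-p18`, gen 31, row g31-#14). THEOREMS ONLY — no definition, no named fact, no instance, no notation.
NOT here: the geometric half (Torelli: every such `θ` with hyperbolic `Λ^θ` containing an ample class comes from a
K3 surface with a non-symplectic involution).

## Contents (all proved; `Λ_{K3} = Matrix.toBilin' k3Gram` on `K3Index → ℤ`)

* `exists_involution_k3Lattice_of_isTwoElementary`: a primitive `S ⊂ Λ_{K3}` with nondegenerate 2-elementary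
  form is `Λ_{K3}^θ` for an isometric involution `θ` with `Λ_{K3,θ} = S^⊥`.
* `primitive_isTwoElementary_of_involution_k3Lattice`: conversely `Λ_{K3}^θ` is primitive and 2-elementary.
* `mem_nikulinMainInvariants_iff_exists_involution`: **the main theorem** above.

## References

* [AlexeevNikulin2006] V. Alexeev, V. V. Nikulin, Del Pezzo and K3 surfaces, MSJ Memoirs 15, Math. Soc. Japan 2006
  (arXiv:math/0406536), §2.2 (p0019) with Figure 1, §9.2 (p0053).
* [Nikulin1980] V. V. Nikulin, Integral symmetric bilinear forms and some of their applications, Math. USSR Izv. 14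
  (1980) 103–167, Cor. 1.5.2, Thm. 3.6.2 (cited through [AlexeevNikulin2006]).
-/

noncomputable section

open Module Function
open LinearMap (BilinForm)
open LinearMap.BilinForm

namespace Literature.AlgebraicGeometry.Surfaces

variable (S : Submodule ℤ (K3Index → ℤ))

/-- **A primitive 2-elementary `S ⊂ Λ_{K3}` (nondegenerate form) is the invariant lattice of an isometric
involution `θ` of `Λ_{K3}`, with `S^⊥` the anti-invariant lattice** (`θ = id_S ⊕ (−id_{S^⊥})` extended).
[cite: AlexeevNikulin2006, §2.2 (p0019), §9.2 (p0053)] [cite: Nikulin1980, Cor. 1.5.2] -/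
theorem exists_involution_k3Lattice_of_isTwoElementary
    (hS : ∀ (k : ℤ) (x : K3Index → ℤ), k ≠ 0 → k • x ∈ S → x ∈ S)
    (hnd : ((Matrix.toBilin' k3Gram).restrict S).Nondegenerate)
    (h2 : ((Matrix.toBilin' k3Gram).restrict S).IsTwoElementary) :
    ∃ θ : (Matrix.toBilin' k3Gram).IsometryEquiv (Matrix.toBilin' k3Gram), (∀ x, θ (θ x) = x) ∧
      (∀ x, x ∈ S ↔ θ x = x) ∧ ∀ x, x ∈ (Matrix.toBilin' k3Gram).orthogonal S ↔ θ x = -x := by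
  haveI : (Matrix.toBilin' k3Gram).IsPerfPair := isUnimodular_toBilin'_k3Gram
  exact h2.exists_involution_fixedLattice_eq _ S isSymm_toBilin'_k3Gram hS hnd

/-- **Conversely, the invariant lattice `Λ_{K3}^θ` of an isometric involution is primitive and 2-elementary**
(the tree's `isTwoElementary_restrict_of_involution_invariant`, Alexeev–Nikulin §2.2, for `Λ_{K3}`).
[cite: AlexeevNikulin2006, §2.2 (p0019: "Thus, the lattice `S` is 2-elementary")] -/
theorem primitive_isTwoElementary_of_involution_k3Lattice
    (θ : (Matrix.toBilin' k3Gram).IsometryEquiv (Matrix.toBilin' k3Gram)) (hθ : ∀ x, θ (θ x) = x)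
    (hSθ : ∀ x, x ∈ S ↔ θ x = x) :
    (∀ (k : ℤ) (x : K3Index → ℤ), k ≠ 0 → k • x ∈ S → x ∈ S) ∧
      ((Matrix.toBilin' k3Gram).restrict S).IsTwoElementary :=
  ⟨fun k x hk hx ↦ mem_of_smul_mem_of_involution_invariant ((θ : (K3Index → ℤ) ≃ₗ[ℤ] (K3Index → ℤ)) :
      (K3Index → ℤ) →ₗ[ℤ] (K3Index → ℤ)) S hSθ k x hk hx,
    (Matrix.toBilin' k3Gram).isTwoElementary_restrict_of_involution_invariant
      ((θ : (K3Index → ℤ) ≃ₗ[ℤ] (K3Index → ℤ)) : (K3Index → ℤ) →ₗ[ℤ] (K3Index → ℤ)) S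
      isUnimodular_toBilin'_k3Gram (fun x y ↦ θ.map_app y x) hθ hSθ⟩

/-- **Main theorem (lattice-theoretic classification of the main invariants).** `(r, a, δ)` is one of the 75
triples of Figure 1 (`nikulinMainInvariants`) iff there is an isometric involution `θ` of `Λ_{K3}` whose
invariant lattice `S = Λ_{K3}^θ` has nondegenerate HYPERBOLIC form (`σ(S) = 2 − rk S`, signature `(1, r − 1)`)
with `rk S = r`, `ℓ(S) = a`, `δ(S) = δ`. (⟹: realise the triple by a primitive 2-elementary hyperbolic `S`,
`exists_primitive_twoElementary_hyperbolic_of_mem`, and extend `id_S ⊕ (−id_{S^⊥})`; ⟸: `Λ^θ` is primitive and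
2-elementary, then `k3_mainInvariants_mem_nikulinMainInvariants`.) [cite: AlexeevNikulin2006, §2.2 (p0019: "All such possibilities for `(r, a, δ)` … are known and are shown on Figure 1"), §9.2 (p0053)] [cite: Nikulin1980, Thm. 3.6.2, Cor. 1.5.2] -/
theorem mem_nikulinMainInvariants_iff_exists_involution (r a δ : ℕ) :
    (r, a, δ) ∈ nikulinMainInvariants ↔
      ∃ (θ : (Matrix.toBilin' k3Gram).IsometryEquiv (Matrix.toBilin' k3Gram)) (S : Submodule ℤ (K3Index → ℤ)),
        (∀ x, θ (θ x) = x) ∧ (∀ x, x ∈ S ↔ θ x = x) ∧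
        ∃ hnd : ((Matrix.toBilin' k3Gram).restrict S).Nondegenerate,
          ((Matrix.toBilin' k3Gram).restrict S).signature = 2 - finrank ℤ S ∧
          finrank ℤ S = r ∧ ((Matrix.toBilin' k3Gram).restrict S).length = a ∧
          ((Matrix.toBilin' k3Gram).restrict S).deltaInvariant hnd (isSymm_toBilin'_k3Gram.restrict S)
            (isEven_restrict isEven_toBilin'_k3Gram S) = δ := by
  constructor
  · intro h
    obtain ⟨S, hS, hnd, h2, hhyp, hr, hℓ, hδ⟩ := exists_primitive_twoElementary_hyperbolic_of_mem r a δ h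
    obtain ⟨θ, hθθ, hfix, -⟩ := exists_involution_k3Lattice_of_isTwoElementary S hS hnd h2
    exact ⟨θ, S, hθθ, hfix, hnd, hhyp, hr, hℓ, hδ⟩
  · rintro ⟨θ, S, hθθ, hfix, hnd, hhyp, hr, hℓ, hδ⟩
    obtain ⟨hS, h2⟩ := primitive_isTwoElementary_of_involution_k3Lattice S θ hθθ hfix
    have h := k3_mainInvariants_mem_nikulinMainInvariants S hS hnd h2 hhyp
    rw [hr, hℓ, hδ] at h
    exact h

end Literature.AlgebraicGeometry.Surfaces
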